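import Literature.IUT.HodgeArakelov.BadPrimeGaussianMonoidsSyncInftyTorsionProofs
import Mathlib.Data.ZMod.Basic
import HarnessLib

/-!
# [IUTchII] Cor 3.5 (ii) / Remark 3.6.1 at the `∞`-level — KERNEL CERTIFICATE that the EXACT label
# synchronization on the roots (and hence the literal diagonal `G_v,⟨F_l^⋇⟩`-stability of `∞Ψ_ξ`) is NOT a
# consequence of the `Ψ`-level data (independence witness; proof-only R-file of the same seat)

S. Mochizuki, *Inter-universal Teichmüller theory II*, kurims Dec-2020 manuscript (paper:url-5036b4059555),
Cor 3.5 (ii) p. 95 («each `Ψ_ξ(M^Θ_*)` is equipped with a natural action by `G_v(M^Θ_*▶)_{⟨F_l^⋇⟩}`» — asserted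
for `Ψ_ξ`; for the roots: «uniquely determined, up to multiplication by an element of the `N`-torsion subgroup
of `Ψ^×_cns(M^Θ_*)_{⟨F_l^⋇⟩}`!»), Rmk 3.6.1 p. 101 [cite: Mochizuki2012, Cor 3.5 (ii) p.95]. Claim key DISPUTED
(D-0012). Record-only witness file (abc-iut cell, layer L6, seat abc-iut-w5-d131); NO `Prop` fact; the
`def`s below are the TOY DATA of the witness (not IUT objects) and nothing here models a genuine `Π_v`.

WHAT IS CERTIFIED.  In the schema of abc-iut-w4-d004's `BadPrimeGaussianMonoidsProofs3.map_pi_diagonalStable` /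
abc-iut-w5-d031's `mrange_pi_diagonalStable` («the case `A = ∞Ψ^ι_env` of Remark 3.6.1») the hypothesis is EXACT
synchronization `hsync` on the whole source monoid.  This file exhibits data `(H, conj, s, β, r, U, θ, ϑ)` — a
faithful miniature of «`σ(q^{t²/N}) = ζ^{t²}·q^{t²/N}`: the root of the theta value at label `t` is moved by a
`t`-DEPENDENT root of unity» (`H = M = μ₄ × ϑ^ℤ` written additively as `ZMod 4 × ℤ`, `θ = ϑ⁴`, two labels, the
label-`1` section acting by `ϑ ↦ ζϑ`, the label-`2` section trivially, restrictions `r₁ = id`,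
`r₂ : ζ^a ϑ^b ↦ ζ^a ϑ^{4b}`) — for which ALL the hypotheses of the satisfiable kind hold:
per-label equivariance `hr` (print's «↞»), unit stability, EXACT synchronization on the `Ψ`-level monoid
`S₀ = U·θ^ℕ` (indeed every section FIXES `S₀` pointwise, the `hfix` of the `Ψ`-level files), the root condition
`ϑ⁴ ∈ S₀` (Prop 1.4 p. 27) and the orbit condition `hΘU` — while (a) exact synchronization on the root `ϑ` FAILS
(`not_sync_root`), and (b) the image of `∞Ψ = U·⟨ϑ⟩` under the product restriction is NOT stable under the
diagonal action (`not_diagonalStable`): the diagonal translate of `(r_t ϑ)_t` is not the restriction family of ANY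
source element (`piIso_pi_root_not_mem_range`).  Hence: the exact-synchronization `∞`-theorems (p416348
`map_pi_inftyDiagonalStable_of_kummer(_of_fixed)`, `inftyRestrictionIso_equivariant_of_kummer(_of_fixed)`, and the
`A = ∞Ψ^ι_env` reading of `mrange_pi_diagonalStable`) carry a hypothesis that is independent of — not derivable
from — the `Ψ`-level inputs; the faithful `∞`-level statement is the UP-TO-TORSION form of
`BadPrimeGaussianMonoidsSyncInftyTorsionProofs.lean` (`pi_conj_eq_mul_piIso_upToTorsion`), which this witness
satisfies with the non-diagonal torsion family `u = (ζ, 1)`.  Independence ≠ refutation of anything printed: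
print asserts the diagonal action for `Ψ_ξ` only.  Nothing here takes a side on [IUTchIII] Cor 3.12.
-/

namespace Literature.IUT.HodgeArakelov

namespace BadPrimeGaussianMonoids

namespace SyncInftyNegative

open TemperedThetaMonoids

/-! ### 1. The toy data -/

/-- The carrier `μ₄ × ϑ^ℤ` written additively: `(a, b) ↔ ζ^a · ϑ^b` (`ζ` a primitive 4th root of unity class,
`ϑ` a 4th root of the theta class `θ = ϑ⁴`). [folklore] -/
abbrev Carrier : Type := Multiplicative (ZMod 4 × ℤ)

/-- «`σ` moves the 4th root by `ζ`»: the additive automorphism `(a, b) ↦ (a + b, b)` of `ZMod 4 × ℤ`. [folklore] -/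
def rootShiftAdd : (ZMod 4 × ℤ) ≃+ (ZMod 4 × ℤ) where
  toFun p := (p.1 + (p.2 : ZMod 4), p.2)
  invFun p := (p.1 - (p.2 : ZMod 4), p.2)
  left_inv p := by ext <;> simp
  right_inv p := by ext <;> simp
  map_add' p q := by
    ext
    · simp only [Prod.fst_add, Prod.snd_add, Int.cast_add]; abel
    · simp only [Prod.snd_add]

/-- The same automorphism of the multiplicative carrier. [folklore] -/
def rootShift : MulAut Carrier := AddEquiv.toMultiplicative rootShiftAdd

/-- The action `n ↦ rootShift^n` of `P = G = ℤ` (playing both `Π_X ⊇ G_v` and the target action `β`). [folklore] -/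
noncomputable def act : Multiplicative ℤ →* MulAut Carrier := zpowersHom (MulAut Carrier) rootShift

/-- The two sections `s_t : G → P`: label `true` ↦ identity (root moved by `ζ`), label `false` ↦ trivial (root
fixed) — they agree on the `Ψ`-level monoid, cf. `act_apply_of_snd_cast_eq_zero`. [folklore] -/
def sec : Bool → (Multiplicative ℤ →* Multiplicative ℤ) := fun b => if b then MonoidHom.id _ else 1

/-- «Restriction at label `2`»: `ζ^a ϑ^b ↦ ζ^a ϑ^{4b}` (the value at label `t = 2` is `q^{t²} = q⁴ = (q^{1/4})^{16}`
— here simplified to `ϑ ↦ ϑ⁴`), additively. [folklore] -/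
def labelTwoAdd : (ZMod 4 × ℤ) →+ (ZMod 4 × ℤ) where
  toFun p := (p.1, 4 * p.2)
  map_zero' := by simp
  map_add' p q := by ext <;> simp [mul_add]

/-- The restriction morphisms `r_t`: identity at label `true`, `labelTwoAdd` at label `false`. [folklore] -/
def restr : Bool → (Carrier →* Carrier) :=
  fun b => if b then MonoidHom.id _ else AddMonoidHom.toMultiplicative labelTwoAdd

/-- The unit group `U = μ₄ = {(a, 0)}` (kernel of the second projection). [folklore] -/
def units : Subgroup Carrier :=
  (AddMonoidHom.toMultiplicative (AddMonoidHom.snd (ZMod 4) ℤ)).ker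

/-- The theta class `θ = ϑ⁴`. [folklore] -/
def theta : Carrier := Multiplicative.ofAdd (0, 4)

/-- The root `ϑ`. [folklore] -/
def root : Carrier := Multiplicative.ofAdd (0, 1)

/-! ### 2. Computations -/

/-- `rootShift (a, b) = (a + b, b)`. [folklore] -/
private theorem rootShift_apply (p : ZMod 4 × ℤ) :
    rootShift (Multiplicative.ofAdd p) = Multiplicative.ofAdd (p.1 + (p.2 : ZMod 4), p.2) := rfl

/-- `rootShift⁻¹ (a, b) = (a - b, b)`. [folklore] -/
private theorem rootShift_symm_apply (p : ZMod 4 × ℤ) :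
    rootShift.symm (Multiplicative.ofAdd p) = Multiplicative.ofAdd (p.1 - (p.2 : ZMod 4), p.2) := rfl

/-- Explicit formula for the powers: `rootShift^n (a, b) = (a + n·b, b)`. [folklore] -/
private theorem rootShift_zpow_apply (n : ℤ) (p : ZMod 4 × ℤ) :
    (rootShift ^ n) (Multiplicative.ofAdd p) = Multiplicative.ofAdd (p.1 + (n : ZMod 4) * (p.2 : ZMod 4), p.2) := by
  induction n using Int.induction_on generalizing p with
  | zero => simp [MulAut.one_apply]
  | succ n ih =>
    rw [zpow_add_one, MulAut.mul_apply, rootShift_apply, ih]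
    congr 1
    ext <;> push_cast <;> ring
  | pred n ih =>
    rw [zpow_sub_one, MulAut.mul_apply, MulAut.inv_apply, rootShift_symm_apply, ih]
    congr 1
    ext <;> push_cast <;> ring

/-- `act n (a, b) = (a + n·b, b)`. [folklore] -/
private theorem act_apply (n : Multiplicative ℤ) (p : ZMod 4 × ℤ) :
    act n (Multiplicative.ofAdd p) =
      Multiplicative.ofAdd (p.1 + (n.toAdd : ZMod 4) * (p.2 : ZMod 4), p.2) := by
  rw [act, zpowersHom_apply, rootShift_zpow_apply]

/-- Elements whose `ϑ`-exponent is `≡ 0 mod 4` — in particular the whole `Ψ`-level monoid `U·θ^ℕ` — are FIXED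
by every `act n`. [folklore] -/
private theorem act_apply_of_snd_cast_eq_zero (n : Multiplicative ℤ) (p : ZMod 4 × ℤ) (hp : (p.2 : ZMod 4) = 0) :
    act n (Multiplicative.ofAdd p) = Multiplicative.ofAdd p := by
  rw [act_apply, hp, mul_zero, add_zero]

/-- `r_true = id`. [folklore] -/
private theorem restr_true : restr true = MonoidHom.id _ := rfl

/-- `r_false (a, b) = (a, 4b)`. [folklore] -/
private theorem restr_false_apply (p : ZMod 4 × ℤ) :
    restr false (Multiplicative.ofAdd p) = Multiplicative.ofAdd (p.1, 4 * p.2) := rfl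

/-- `s_true = id`. [folklore] -/
private theorem sec_true (g : Multiplicative ℤ) : sec true g = g := rfl

/-- `s_false = 1`. [folklore] -/
private theorem sec_false (g : Multiplicative ℤ) : sec false g = 1 := rfl

/-- `U = {(a, 0)}`. [folklore] -/
private theorem mem_units_iff (x : Carrier) : x ∈ units ↔ (Multiplicative.toAdd x).2 = 0 := by
  simp only [units, MonoidHom.mem_ker]
  rfl

/-- Membership in the `Ψ`-level monoid `S₀ = U·θ^ℕ` forces `ϑ`-exponent `≡ 0 mod 4`. [folklore] -/
private theorem snd_cast_eq_zero_of_mem_thetaSplit {x : Carrier}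
    (hx : x ∈ splitMonoid units (Submonoid.powers theta)) : ((Multiplicative.toAdd x).2 : ZMod 4) = 0 := by
  obtain ⟨u, hu, _, ⟨k, rfl⟩, rfl⟩ := (mem_splitMonoid_iff _ _ _).mp hx
  rw [mem_units_iff] at hu
  have h4 : (4 : ZMod 4) = 0 := by decide
  simp [toAdd_mul, toAdd_pow, theta, hu, h4]

/-! ### 3. The hypotheses of the satisfiable kind all hold -/

/-- `hr` (print's «↞»): each restriction `r_t` is equivariant along its section `s_t`. [cite: Mochizuki2012, Cor 3.5 (ii) p.95] -/
theorem hr_holds : ∀ (t : Bool) (g : Multiplicative ℤ) (x : Carrier), restr t (act (sec t g) x) = act g (restr t x) := by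
  rintro (_ | _) g x
  · -- label `false`: trivial section; the label-2 value `ϑ⁴ᵇ` is fixed by `act g`
    rw [sec_false, map_one act, MulAut.one_apply]
    obtain ⟨p, rfl⟩ := Multiplicative.ofAdd.surjective x
    rw [restr_false_apply, act_apply_of_snd_cast_eq_zero]
    have h4 : (4 : ZMod 4) = 0 := by decide
    simp [h4]
  · rw [sec_true, restr_true, MonoidHom.id_apply, MonoidHom.id_apply]

/-- Unit stability. [cite: Mochizuki2012, Cor 3.5 (ii) p.95] -/
theorem units_stable : ∀ (n : Multiplicative ℤ) (u : Carrier), u ∈ units → act n u ∈ units := by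
  intro n u hu
  obtain ⟨p, rfl⟩ := Multiplicative.ofAdd.surjective u
  rw [mem_units_iff] at hu ⊢
  rw [act_apply]
  simpa using hu

/-- EXACT synchronization on the `Ψ`-level monoid `S₀ = U·θ^ℕ` (indeed pointwise fixed: the `hfix` of the
`Ψ`-level files holds here). [cite: Mochizuki2012, Cor 3.5 (ii) p.95] -/
theorem sync_thetaSplit : ∀ (g : Multiplicative ℤ) (t t' : Bool), ∀ x ∈ splitMonoid units (Submonoid.powers theta),
    act (sec t g) x = act (sec t' g) x := by
  intro g t t' x hx
  have h := snd_cast_eq_zero_of_mem_thetaSplit hx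
  obtain ⟨p, rfl⟩ := Multiplicative.ofAdd.surjective x
  have hfix : ∀ n : Multiplicative ℤ, act n (Multiplicative.ofAdd p) = Multiplicative.ofAdd p :=
    fun n => act_apply_of_snd_cast_eq_zero n p h
  rw [hfix, hfix]

/-- The root condition of Prop 1.4 p. 27: `ϑ⁴ = θ ∈ S₀`. [cite: Mochizuki2012, Cor 3.5 (ii) p.95] -/
theorem root_pow_mem : ∀ ϑ ∈ ({root} : Set Carrier), ∃ N : ℕ, 0 < N ∧ ϑ ^ N ∈ splitMonoid units (Submonoid.powers theta) := by
  intro ϑ hϑ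
  rw [Set.mem_singleton_iff] at hϑ
  subst hϑ
  refine ⟨4, by norm_num, (mem_splitMonoid_iff _ _ _).mpr ⟨1, Subgroup.one_mem _, theta, Submonoid.mem_powers _, ?_⟩⟩
  rw [one_mul]; rfl

/-- The ORBIT condition `hΘU` (print: «up to multiplication by an element of the N-torsion subgroup»): every
section moves the root within its `U`-orbit. [cite: Mochizuki2012, Cor 3.5 (ii) p.95] -/
theorem root_orbit : ∀ (g : Multiplicative ℤ) (t : Bool), ∀ ϑ ∈ ({root} : Set Carrier),
    ∃ u ∈ units, act (sec t g) ϑ = u * ϑ := by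
  intro g t ϑ hϑ
  rw [Set.mem_singleton_iff] at hϑ
  subst hϑ
  refine ⟨Multiplicative.ofAdd (((sec t g).toAdd : ZMod 4), 0), (mem_units_iff _).mpr rfl, ?_⟩
  rw [root, act_apply, ← ofAdd_add]
  congr 1
  ext <;> simp

/-! ### 4. … but exact synchronization on the root and diagonal stability FAIL -/

/-- (a) The two sections do NOT act identically on the root `ϑ` (`ζϑ ≠ ϑ`). [cite: Mochizuki2012, Cor 3.5 (ii) p.95] -/
theorem not_sync_root :
    ¬ (act (sec true (Multiplicative.ofAdd 1)) root = act (sec false (Multiplicative.ofAdd 1)) root) := by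
  rw [sec_true, sec_false, map_one act, MulAut.one_apply, root, act_apply]
  intro h
  have h' := congrArg (fun x => (Multiplicative.toAdd x).1) h
  simp at h'
  exact absurd h' (by decide)

/-- (b) The diagonal translate of the restriction family of the root is not the restriction family of ANY source
element. [cite: Mochizuki2012, Cor 3.5 (ii) p.95] -/
theorem piIso_pi_root_not_mem_range :
    piIso Bool (act (Multiplicative.ofAdd 1)) (MonoidHom.pi restr root) ∉ Set.range (MonoidHom.pi restr) := by
  rintro ⟨y, hy⟩
  have h₁ := congrFun hy true
  have h₂ := congrFun hy false
  simp only [MonoidHom.pi_apply, piIso, MulEquiv.piCongrRight_apply, restr_true, MonoidHom.id_apply] at h₁ h₂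
  -- `y = act 1 ϑ = ζϑ`
  subst h₁
  rw [root, act_apply, restr_false_apply, restr_false_apply, act_apply] at h₂
  have h' := congrArg (fun x => (Multiplicative.toAdd x).1) h₂
  simp at h'
  exact absurd h' (by decide)

/-- **Independence certificate.** The image of `∞Ψ = U·⟨ϑ⟩` under the product restriction is NOT stable under
the diagonal action — although `hr`, unit stability, EXACT synchronization on `U·θ^ℕ`, the root condition and the
orbit condition all hold (§3).  Hence the `hsync`-on-`∞Ψ^ι_env` hypothesis of the exact-diagonal `∞`-theorems is
not derivable from those inputs. [cite: Mochizuki2012, Cor 3.5 (ii) p.95] -/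
theorem not_diagonalStable :
    ¬ ((splitMonoid units (Submonoid.closure {root})).map (MonoidHom.pi restr)).map
        (piIso Bool (act (Multiplicative.ofAdd 1))).toMonoidHom =
      (splitMonoid units (Submonoid.closure {root})).map (MonoidHom.pi restr) := by
  intro h
  have hroot : root ∈ splitMonoid units (Submonoid.closure {root}) :=
    (mem_splitMonoid_iff _ _ _).mpr ⟨1, Subgroup.one_mem _, root, Submonoid.subset_closure rfl, one_mul _⟩
  have hmem : piIso Bool (act (Multiplicative.ofAdd 1)) (MonoidHom.pi restr root) ∈
      (splitMonoid units (Submonoid.closure {root})).map (MonoidHom.pi restr) := by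
    rw [← h]
    exact ⟨_, ⟨root, hroot, rfl⟩, rfl⟩
  obtain ⟨y, -, hy⟩ := hmem
  exact piIso_pi_root_not_mem_range ⟨y, hy⟩

/-- The witness DOES satisfy the faithful up-to-torsion form (`pi_conj_eq_mul_piIso_upToTorsion`) — e.g. for
the root with the NON-diagonal torsion family `u = (ζ, 1)` — so "up to torsion" is the right `∞`-level statement
and cannot be improved to "exactly" here. [cite: Mochizuki2012, Cor 3.5 (ii) p.95] -/
theorem upToTorsion_holds (x : Carrier) (hx : x ∈ splitMonoid units (Submonoid.closure ({root} : Set Carrier)))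
    (t₀ : Bool) (g : Multiplicative ℤ) :
    ∃ (N : ℕ) (u : Bool → Carrier), 0 < N ∧ (∀ t, u t ^ N = 1) ∧
      MonoidHom.pi restr (act (sec t₀ g) x) = (fun t => restr t (u t)) * piIso Bool (act g) (MonoidHom.pi restr x) := by
  obtain ⟨N, hN, hxN⟩ := exists_pow_mem_of_mem_splitMonoid_closure units {root} _
    (fun u hu => (mem_splitMonoid_iff _ _ _).mpr ⟨u, hu, 1, Submonoid.one_mem _, mul_one u⟩) root_pow_mem x hx
  obtain ⟨u, hu, h⟩ := pi_conj_eq_mul_piIso_upToTorsion act sec act restr hr_holds _ sync_thetaSplit hxN t₀ g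
  exact ⟨N, u, hN, hu, h⟩


/-- **Packaged, data-free form of the certificate** (for citation by the sub-DAG / NODES bookkeeping): there are
data of the `Ψ`-level kind — per-label equivariant restrictions, stable units, EXACT synchronization on `U·θ^ℕ`,
roots with a power in `U·θ^ℕ` moving within their `U`-orbits — for which exact synchronization on `U·⟨roots⟩`
FAILS and the restriction image of `U·⟨roots⟩` is NOT diagonally stable. [cite: Mochizuki2012, Cor 3.5 (ii) p.95] -/
theorem exists_psiLevelData_not_inftyDiagonalStable :
    ∃ (H : Type) (_ : CommGroup H) (P : Type) (_ : Group P) (conj : P →* MulAut H) (T : Type) (G : Type)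
      (_ : Group G) (s : T → (G →* P)) (M : Type) (_ : CommMonoid M) (β : G →* MulAut M) (r : T → (H →* M))
      (U : Subgroup H) (θ : H) (Θ : Set H),
      (∀ t g x, r t (conj (s t g) x) = β g (r t x)) ∧
      (∀ p u, u ∈ U → conj p u ∈ U) ∧
      (∀ g t t', ∀ x ∈ splitMonoid U (Submonoid.powers θ), conj (s t g) x = conj (s t' g) x) ∧
      (∀ ϑ ∈ Θ, ∃ N : ℕ, 0 < N ∧ ϑ ^ N ∈ splitMonoid U (Submonoid.powers θ)) ∧
      (∀ g t, ∀ ϑ ∈ Θ, ∃ u ∈ U, conj (s t g) ϑ = u * ϑ) ∧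
      ¬ (∀ g t t', ∀ x ∈ splitMonoid U (Submonoid.closure Θ), conj (s t g) x = conj (s t' g) x) ∧
      ∃ g, ¬ ((splitMonoid U (Submonoid.closure Θ)).map (MonoidHom.pi r)).map (piIso T (β g)).toMonoidHom =
          (splitMonoid U (Submonoid.closure Θ)).map (MonoidHom.pi r) := by
  refine ⟨Carrier, inferInstance, Multiplicative ℤ, inferInstance, act, Bool, Multiplicative ℤ, inferInstance, sec,
    Carrier, inferInstance, act, restr, units, theta, {root}, hr_holds, units_stable, sync_thetaSplit, root_pow_mem,
    root_orbit, fun h => not_sync_root (h _ _ _ root ?_), ⟨Multiplicative.ofAdd 1, not_diagonalStable⟩⟩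
  exact (mem_splitMonoid_iff _ _ _).mpr ⟨1, Subgroup.one_mem _, root, Submonoid.subset_closure rfl, one_mul _⟩

end SyncInftyNegative

end BadPrimeGaussianMonoids

end Literature.IUT.HodgeArakelov
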